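import Literature.NumberTheory.EllipticCurves.H1CorestrictionIndexTwo
import Literature.NumberTheory.EllipticCurves.SubgroupSelmerCocycleCriteriaProofs
import Literature.NumberTheory.EllipticCurves.GreenbergVatsal2000.GreenbergSelmerGroups
import Literature.NumberTheory.GaloisRepresentations.KummerGalFixing
import Summits.BirchSwinnertonDyer.BirchSwinnertonDyer.Theorems.PrintCf2SplitBadTwoKummerUProNullAssembly
import Summits.BirchSwinnertonDyer.BirchSwinnertonDyer.Theorems.PrintCf2SplitBadTwoUpperBaseLiftSelmer
import HarnessLib

/-!
# Crux `PrintCf2.SplitBadTwoRankOneOfFacts` (stmt-BirchSwinnertonDyer-20368), S3n′-FACT-FREE road, R2 brick B4e: the CLASS-LEVEL ADAPTER —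
# from a class of `H¹(U, X)` (any coefficient model `X ↪ K̄ˣ` of a twisted `μ_{p^M}`) and its `awayKer` / `unramifiedKer` conditions to the
# ROOT FORM of (PRO-NULL)_U, and from the root/coboundary conclusion back to «the pushed class is `0` in `H¹(U, X₀)`»

Cell `bsd-print-cf2`, EXTRA WIDTH seat `bsd-line-cf2-p1-w3` g13 (prover-bsd-line-cf2-p1-w3-g13-0); `--supports stmt-BirchSwinnertonDyer-20368`
(helper, Theses-free). HONEST FRAMING: nothing here closes the crux or a registered stub; BSD is not proved by any of this; no summit
statement is proved by this seat. No definition, no named fact, no `sorry`. UNCONDITIONAL; COEFFICIENT-GENERIC: `X` is ANY discrete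
`Γ_K`-module with an injective additive map `ι : X → Additive K̄ˣ` that is `ε`-twisted-equivariant (`ι(g•x) = (g•ι x)^{ε g}`, `ε : Γ_K →* ℤˣ`;
`ε = 1` untwisted) — e.g. `MuCarrier K n` (`muVal`), `TateDual K (ℤ/p^M) (p^M)` (evaluation at `1`), or their `θ`-twists — so the bricks of the
`U`-currency level lift (-w5 g7 B2c/B2d in `subgroupH1 U _` + `conjH1`/`awayKer`/`unramifiedKer` currency, -w4 g12 B3) meet the ROOT-FORM
arithmetic input (B4b/B4c/B4d p701755/p701271/p702625, θ-bookkeeping p703424) without fixing a coefficient model.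

* §1 `twistedCocycle_of_oneCocycle` — the function `c_φ : Γ_K → K̄ˣ`, `g ↦ ι(φ g)` on `U` (and `1` off `U`), attached to a continuous `1`-cocycle
  `φ` of `U` in `X`, is an `ε`-twisted cocycle on `U`; `pow_eq_one_of_…` (`c_φ^{N} = 1` if `N•X = 0`).
* §2 LOCAL CONDITIONS → ROOT FORM (on the untwisted part `U′ ≤ U`, `ε|_{U′} = 1`, `U′ ⊴ Γ_K`, where `c_φ|_{U′}` is the Kummer cocycle of `β`):
  `exists_root_fixed_of_resOfLe_conjH1_eq_zero` — `resOfLe X (U ⊓ V ≤ U) (conjH1 U X σ [φ]) = 0` (e.g. `conjH1 σ [φ] ∈ awayKer U X v`, `V = D_v`)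
  ⟹ some `β′` with `β′^N = β^N` is fixed by `{τ ∈ U′ : στσ⁻¹ ∈ V}`; `exists_root_fixed_of_conjH1_mem_unramifiedKer` — the same from
  `conjH1 σ [φ] ∈ unramifiedKer U X w` with `V = I_w`.
* §3 CONCLUSION ← COBOUNDARY FORM: `resH1Hom_id_eq_zero_of_twistedCoboundary` — if `c_φ(g)^{p^{M−k}} = (g•m)^{ε g}/m` on `U` for some `m` in the
  image of `ι₀ : X₀ ↪ K̄ˣ` and `ι₀ ∘ t = (·)^{p^{M−k}} ∘ ι` for the level map `t : X →+ X₀`, then `resH1Hom id t [φ] = 0` in `H¹(U, X₀)`.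
* §4 **`exists_level_resH1Hom_eq_zero_of_local`** — THE CLASS-LEVEL (PRO-NULL)_U AT `θ = 1` (untwisted, `U = Gal(K̄/F)`, `F/K` abelian, `K`
  imaginary quadratic, `p = v v̄`): ∀ k ∃ M ≥ k such that for ALL coefficient models `ι : X ↪ K̄ˣ` (`p^M • X = 0`), `ι₀ : X₀ ↪ K̄ˣ` hitting `μ_{p^k}`,
  level map `t` with `ι₀ ∘ t = (·)^{p^{M−k}} ∘ ι`, every class `y ∈ H¹(U, X)` with `conj_σ y ∈ awayKer U X v` (all `σ`), `conj_σ y ∈ unramifiedKer U X w`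
  (all `σ`, all `w ∉ {v, v̄}`) and whose Kummer element has `p^M ∣ ord` at the places above `v̄` satisfies `resH1Hom id t y = 0` — B2d's wanted
  socket shape (-w5 g7 `R2-BRICKS` §5), discharged by B4d′ (p702625) through §1–§3.
presearch: Serre Local Fields X §3 (Kummer), NSW I §5 (conjugation on cochains); tree: `CocycleCriteria.*`, `conjH1_oneCocycleClass`,
`KummerGalFixing` — pure plumbing, no new fact. beyond-print theorem: no.

References: [SerreLocalFields1979] X §3 b); [NeukirchSchmidtWingberg2008] I §5; [SerreGaloisCohomology1997] I §2.4–2.5.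
-/

noncomputable section

set_option linter.dupNamespace false
set_option autoImplicit false

open scoped Classical
open Field
open Literature.NumberTheory.EllipticCurves Literature.NumberTheory.EllipticCurves.GreenbergSelmer
open Literature.NumberTheory.EllipticCurves.GreenbergVatsal2000
open Literature.NumberTheory.GaloisRepresentations Literature.NumberTheory.GaloisRepresentations.LocalWeilDatum

namespace Summit.BirchSwinnertonDyer.BirchSwinnertonDyer.Theorems.PrintCf2.KummerU

variable {K : Type} [Field K]
  {X : Type} [AddCommGroup X] [DistribMulAction (absoluteGaloisGroup K) X] [TopologicalSpace X] [DiscreteTopology X]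
  (U : Subgroup (absoluteGaloisGroup K)) (ε : absoluteGaloisGroup K →* ℤˣ)
  (ι : X →+ Additive (AlgebraicClosure K)ˣ)

/-! ## §1. From a continuous `1`-cocycle of `U` in `X` to an `ε`-twisted cocycle `U → K̄ˣ` -/

section ToCocycle

/-- **Cocycle of `U` in `X` ⟹ `ε`-twisted cocycle `U → K̄ˣ`.** For an `ε`-twisted-equivariant additive `ι : X → K̄ˣ`
(`ι(g•x) = (g•ι x)^{ε g}`) and a continuous `1`-cocycle `φ` of `U` in `X`, the function `g ↦ ι(φ g)` (extended by `1` off `U`) satisfies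
`c(gh) = c(g)·(g•c(h))^{ε g}` on `U`, and `c^N = 1` on `U` if `N • X = 0`. [cite: NeukirchSchmidtWingberg2008, I §5 (cochains)] -/
theorem exists_twistedCocycle_of_oneCocycle
    (hι : ∀ (g : absoluteGaloisGroup K) (x : X), Additive.toMul (ι (g • x)) = (g • Additive.toMul (ι x)) ^ ((ε g : ℤˣ) : ℤ))
    (φ : contOneCocycles (discreteTopRep U X)) {N : ℕ} (hN : ∀ x : X, N • x = 0) :
    ∃ c : absoluteGaloisGroup K → (AlgebraicClosure K)ˣ,
      (∀ (g : absoluteGaloisGroup K) (hg : g ∈ U), c g = Additive.toMul (ι (φ.1 ⟨g, hg⟩))) ∧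
      (∀ g ∈ U, ∀ h ∈ U, c (g * h) = c g * (g • c h) ^ ((ε g : ℤˣ) : ℤ)) ∧
      (∀ g ∈ U, c g ^ N = 1) := by
  refine ⟨fun g ↦ if h : g ∈ U then Additive.toMul (ι (φ.1 ⟨g, h⟩)) else 1, fun g hg ↦ dif_pos hg, fun g hg h hh ↦ ?_,
    fun g hg ↦ ?_⟩
  · simp only [dif_pos hg, dif_pos hh, dif_pos (U.mul_mem hg hh)]
    have hcoc : φ.1 (⟨g, hg⟩ * ⟨h, hh⟩) = φ.1 ⟨g, hg⟩ + (g • φ.1 ⟨h, hh⟩ : X) := φ.2 ⟨g, hg⟩ ⟨h, hh⟩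
    rw [show (⟨g * h, U.mul_mem hg hh⟩ : U) = ⟨g, hg⟩ * ⟨h, hh⟩ from rfl, hcoc, map_add, toMul_add, hι]
  · simp only [dif_pos hg]
    rw [← toMul_nsmul, ← map_nsmul, hN, map_zero, toMul_zero]

end ToCocycle

/-! ## §2. Local conditions on the class ⟹ fixed roots (root form), on the untwisted part `U′ ≤ U` -/

section Local

variable {U ε ι}

/-- **`res ∘ conj_σ` vanishing ⟹ a fixed root.** Let `φ` be a continuous `1`-cocycle of `U` in `X` whose attached function `c` (§1) is, on a
NORMAL subgroup `U′ ≤ U` of `Γ_K` on which `ε = 1`, the Kummer cocycle `u ↦ uβ/β` of `β ∈ K̄ˣ`. If `resOfLe X (U ⊓ V ≤ U) (conj_σ [φ]) = 0`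
for a subgroup `V ≤ Γ_K` (e.g. `V = D_v`: `conj_σ [φ] ∈ awayKer U X v`), then some `β′` with `β′^N = β^N` (`N • X = 0`) is fixed by every
`τ ∈ U′` with `στσ⁻¹ ∈ V`. [cite: SerreLocalFields1979, X §3 b)] [cite: NeukirchSchmidtWingberg2008, I §5] -/
theorem exists_root_fixed_of_resOfLe_conjH1_eq_zero [U.Normal]
    (hι : ∀ (g : absoluteGaloisGroup K) (x : X), Additive.toMul (ι (g • x)) = (g • Additive.toMul (ι x)) ^ ((ε g : ℤˣ) : ℤ))
    (φ : contOneCocycles (discreteTopRep U X)) {N : ℕ} (hN : ∀ x : X, N • x = 0)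
    {c : absoluteGaloisGroup K → (AlgebraicClosure K)ˣ} (hc : ∀ (g : absoluteGaloisGroup K) (hg : g ∈ U), c g = Additive.toMul (ι (φ.1 ⟨g, hg⟩)))
    {U' : Subgroup (absoluteGaloisGroup K)} [U'.Normal] (hU' : U' ≤ U) (hεU' : ∀ u ∈ U', ε u = 1)
    {β : (AlgebraicClosure K)ˣ} (hres : ∀ u ∈ U', c u = u • β / β)
    (V : Subgroup (absoluteGaloisGroup K)) (σ : absoluteGaloisGroup K)
    (h0 : resOfLe X (inf_le_left : U ⊓ V ≤ U) (conjH1 U X σ (oneCocycleClass _ φ)) = 0) :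
    ∃ β' : (AlgebraicClosure K)ˣ, β' ^ N = β ^ N ∧ ∀ τ ∈ U', σ * τ * σ⁻¹ ∈ V → τ • β' = β' := by
  -- cocycle-level reading of `res ∘ conj_σ = 0`
  obtain ⟨a, ha⟩ := (CocycleCriteria.conjH1_oneCocycleClass_mem_ker_resOfLe_iff (inf_le_left : U ⊓ V ≤ U) σ φ).1 h0
  set m : (AlgebraicClosure K)ˣ := Additive.toMul (ι a) with hm
  have hmN : m ^ N = 1 := by rw [hm, ← toMul_nsmul, ← map_nsmul, hN, map_zero, toMul_zero]
  -- the key identity `(σ • (τβ/β))^{ε σ} = (στσ⁻¹)•m / m` for `τ ∈ U′` with `στσ⁻¹ ∈ V`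
  have key : ∀ τ ∈ U', σ * τ * σ⁻¹ ∈ V →
      (σ • (τ • β / β)) ^ ((ε σ : ℤˣ) : ℤ) = (σ * τ * σ⁻¹) • m / m := by
    intro τ hτ hτV
    have hτ'U : σ * τ * σ⁻¹ ∈ U := ‹U.Normal›.conj_mem τ (hU' hτ) σ
    have h1 := ha ⟨σ * τ * σ⁻¹, ⟨hτ'U, hτV⟩⟩
    have e1 : (subgroupConj U σ (Subgroup.inclusion (inf_le_left : U ⊓ V ≤ U) ⟨σ * τ * σ⁻¹, ⟨hτ'U, hτV⟩⟩) : U) = ⟨τ, hU' hτ⟩ :=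
      Subtype.ext (by simp only [subgroupConj_apply_coe, Subgroup.coe_inclusion]; group)
    rw [e1] at h1
    have h2 := congrArg (fun x ↦ Additive.toMul (ι x)) h1
    simp only [map_sub, toMul_sub, hι] at h2
    have hετ' : ((ε (σ * τ * σ⁻¹) : ℤˣ) : ℤ) = 1 := by
      rw [map_mul, map_mul, map_inv, hεU' τ hτ, mul_one, mul_inv_cancel, Units.val_one]
    rw [← hc τ (hU' hτ), hres τ hτ, hετ', zpow_one] at h2
    exact h2
  -- `σ⁻¹` applied: `(τβ/β)^{ε σ} = τ•m′/m′`, `m′ = σ⁻¹ m`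
  have key2 : ∀ τ ∈ U', σ * τ * σ⁻¹ ∈ V → (τ • β / β) ^ ((ε σ : ℤˣ) : ℤ) = τ • (σ⁻¹ • m) / (σ⁻¹ • m) := by
    intro τ hτ hτV
    have h := congrArg (fun x ↦ σ⁻¹ • x) (key τ hτ hτV)
    simp only [smul_zpow', smul_div', smul_smul, mul_assoc, inv_mul_cancel_left, inv_mul_cancel, one_smul] at h
    rw [mul_smul] at h
    exact h
  have hm'N : (σ⁻¹ • m) ^ N = 1 := by rw [← smul_pow', hmN, smul_one]
  rcases Int.units_eq_one_or (ε σ) with hε | hε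
  · -- `ε σ = 1`: `β′ = β / m′`
    refine ⟨β / σ⁻¹ • m, by rw [div_pow, hm'N, div_one], fun τ hτ hτV ↦ ?_⟩
    have h := key2 τ hτ hτV
    rw [hε, Units.val_one, zpow_one, div_eq_div_iff_mul_eq_mul] at h
    rw [smul_div', div_eq_div_iff_mul_eq_mul, h, mul_comm]
  · -- `ε σ = −1`: `β′ = β · m′`
    refine ⟨β * σ⁻¹ • m, by rw [mul_pow, hm'N, mul_one], fun τ hτ hτV ↦ ?_⟩
    have h := key2 τ hτ hτV
    rw [hε, Units.val_neg, Units.val_one, zpow_neg, zpow_one, inv_div, div_eq_div_iff_mul_eq_mul] at h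
    -- h : β * σ⁻¹ • m = τ • σ⁻¹ • m * τ • β
    rw [smul_mul', h, mul_comm]

/-- The same from the UNRAMIFIED condition: `resOfLe X (U ⊓ I_w ≤ U) (conj_σ [φ]) = 0` (= `conj_σ [φ] ∈ unramifiedKer U X w` by -w4 g12
`UpperBaseLift.mem_unramifiedKer_iff_resOfLe_inf_inertia_eq_zero`) ⟹ a root `β′`, `β′^N = β^N`, fixed by `{τ ∈ U′ : στσ⁻¹ ∈ I_w}`; and from
`conj_σ [φ] ∈ awayKer U X v` (definitionally `resOfLe X (U ⊓ D_v ≤ U) (conj_σ [φ]) = 0`) ⟹ fixed by `{τ ∈ U′ : στσ⁻¹ ∈ D_v}`. Both are the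
case `V = I_w`, `V = D_v` of `exists_root_fixed_of_resOfLe_conjH1_eq_zero`. [cite: SerreLocalFields1979, X §3 b)] -/
theorem exists_root_fixed_of_conjH1_mem_awayKer [NumberField K] [U.Normal]
    (hι : ∀ (g : absoluteGaloisGroup K) (x : X), Additive.toMul (ι (g • x)) = (g • Additive.toMul (ι x)) ^ ((ε g : ℤˣ) : ℤ))
    (φ : contOneCocycles (discreteTopRep U X)) {N : ℕ} (hN : ∀ x : X, N • x = 0)
    {c : absoluteGaloisGroup K → (AlgebraicClosure K)ˣ} (hc : ∀ (g : absoluteGaloisGroup K) (hg : g ∈ U), c g = Additive.toMul (ι (φ.1 ⟨g, hg⟩)))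
    {U' : Subgroup (absoluteGaloisGroup K)} [U'.Normal] (hU' : U' ≤ U) (hεU' : ∀ u ∈ U', ε u = 1)
    {β : (AlgebraicClosure K)ˣ} (hres : ∀ u ∈ U', c u = u • β / β)
    (v : IsDedekindDomain.HeightOneSpectrum (NumberField.RingOfIntegers K)) (σ : absoluteGaloisGroup K)
    (h0 : conjH1 U X σ (oneCocycleClass _ φ) ∈ awayKer U X v) :
    ∃ β' : (AlgebraicClosure K)ˣ, β' ^ N = β ^ N ∧ ∀ τ ∈ U', σ * τ * σ⁻¹ ∈ decomp v → τ • β' = β' :=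
  exists_root_fixed_of_resOfLe_conjH1_eq_zero hι φ hN hc hU' hεU' hres (decomp v) σ h0

end Local

/-! ## §3. From the coboundary form of the conclusion back to the class: the pushed class vanishes -/

section Push

variable {U ε ι}

/-- **Twisted coboundary ⟹ pushed class `= 0`.** Let `t : X →+ X₀` be `Γ_K`-equivariant (the level map) with `ι₀ ∘ t = (·)^q ∘ ι` for an
injective `ε`-twisted-equivariant `ι₀ : X₀ → K̄ˣ`. If `c_φ(g)^q = (g•m)^{ε g}/m` on `U` for some `m = ι₀(a₀)`, then the class of `φ` pushed to
`H¹(U, X₀)` vanishes: `resH1Hom id t [φ] = 0`. [cite: SerreGaloisCohomology1997, I §2.4] [cite: NeukirchSchmidtWingberg2008, I §5] -/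
theorem resH1Hom_id_eq_zero_of_twistedCoboundary
    {X₀ : Type} [AddCommGroup X₀] [DistribMulAction (absoluteGaloisGroup K) X₀] [TopologicalSpace X₀] [DiscreteTopology X₀]
    (ι₀ : X₀ →+ Additive (AlgebraicClosure K)ˣ) (hι₀inj : Function.Injective ι₀)
    (hι₀ : ∀ (g : absoluteGaloisGroup K) (x : X₀), Additive.toMul (ι₀ (g • x)) = (g • Additive.toMul (ι₀ x)) ^ ((ε g : ℤˣ) : ℤ))
    (t : X →+ X₀) (ht : ∀ (g : absoluteGaloisGroup K) (x : X), t (g • x) = g • t x) {q : ℕ}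
    (htι : ∀ x : X, Additive.toMul (ι₀ (t x)) = Additive.toMul (ι x) ^ q)
    (φ : contOneCocycles (discreteTopRep U X))
    {c : absoluteGaloisGroup K → (AlgebraicClosure K)ˣ} (hc : ∀ (g : absoluteGaloisGroup K) (hg : g ∈ U), c g = Additive.toMul (ι (φ.1 ⟨g, hg⟩)))
    {m : (AlgebraicClosure K)ˣ} (hm : ∃ a₀ : X₀, Additive.toMul (ι₀ a₀) = m)
    (hcob : ∀ g ∈ U, c g ^ q = (g • m) ^ ((ε g : ℤˣ) : ℤ) / m) :
    resH1Hom (ContinuousMonoidHom.id U) t (fun g x ↦ ht g x) (oneCocycleClass _ φ) = 0 := by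
  obtain ⟨a₀, ha₀⟩ := hm
  refine (CocycleCriteria.resH1Hom_oneCocycleClass_eq_zero_iff (ContinuousMonoidHom.id U) t (fun g x ↦ ht g x) φ).2 ⟨a₀, fun g ↦ ?_⟩
  apply hι₀inj
  apply Additive.toMul.injective
  change Additive.toMul (ι₀ (t (φ.1 g))) = Additive.toMul (ι₀ ((g : absoluteGaloisGroup K) • a₀ - a₀))
  rw [htι, ← hc g g.2, hcob g g.2, map_sub, toMul_sub, hι₀, ha₀]

end Push

/-! ## §4. The class-level (PRO-NULL)_U at `θ = 1` -/

section Assembly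

open NumberField IsDedekindDomain
open Summit.BirchSwinnertonDyer.BirchSwinnertonDyer.Theorems.PrintCf2.UpperBaseLift (mem_unramifiedKer_iff_resOfLe_inf_inertia_eq_zero)

variable [NumberField K] {p : ℕ} [Fact p.Prime]

/-- **CLASS-LEVEL (PRO-NULL)_U, `θ = 1`.** `K` imaginary quadratic, `p = v·v̄`, `F ⊆ K̄` finite abelian over `K` with `U = Gal(K̄/F)` normal in `Γ_K`.
For every `k` there is `M ≥ k` such that: for every pair of coefficient models `ι : X ↪ K̄ˣ` (equivariant, injective, `p^M • X = 0`) and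
`ι₀ : X₀ ↪ K̄ˣ` (equivariant, injective, every `p^k`-th root of unity in its image) with an equivariant level map `t : X → X₀`,
`ι₀ ∘ t = (·)^{p^{M−k}} ∘ ι`, every class `y ∈ H¹(U, X)` which is
(v) locally trivial at all places above `v` (`∀ σ, conj_σ y ∈ awayKer U X v`),
(unr) unramified at all places above every `w ∉ {v, v̄}` (`∀ σ, conj_σ y ∈ unramifiedKer U X w`), and
(v̄) whose Kummer element `b ∈ Fˣ` (any `β` with `ι(φ u) = uβ/β` on `U` for a cocycle `φ` of `y`, `b = β^{p^M}`) has `p^M ∣ ord_{w′}(b)` for all `w′ ∣ v̄`,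
has VANISHING PUSH-FORWARD `resH1Hom id t y = 0 ∈ H¹(U, X₀)`. (= B4d′ `exists_level_forall_exists_pow_eq_of_galois′` through §1–§3 and
`KummerGalFixing`.) [cite: deShalit1987, III.2.3 (Theorem (Baker–Brumer))] [cite: SerreLocalFields1979, X §3 b)]
[cite: NeukirchSchmidtWingberg2008, I §5] -/
theorem exists_level_resH1Hom_eq_zero_of_local (hK : IsImaginaryQuadratic K) {v vbar : HeightOneSpectrum (𝓞 K)}
    (hv : ((p : ℕ) : 𝓞 K) ∈ v.asIdeal) (hvbar : ((p : ℕ) : 𝓞 K) ∈ vbar.asIdeal) (hne : vbar ≠ v)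
    (F : IntermediateField K (AlgebraicClosure K)) [FiniteDimensional K F] [IsAbelianGalois K F] [NumberField F]
    [(galFixing K F).Normal] (k : ℕ) :
    ∃ M : ℕ, k ≤ M ∧
      ∀ {X : Type} [AddCommGroup X] [DistribMulAction (absoluteGaloisGroup K) X] [TopologicalSpace X] [DiscreteTopology X]
        {X₀ : Type} [AddCommGroup X₀] [DistribMulAction (absoluteGaloisGroup K) X₀] [TopologicalSpace X₀] [DiscreteTopology X₀]
        (ι : X →+ Additive (AlgebraicClosure K)ˣ) (_ : Function.Injective ι)
        (_ : ∀ (g : absoluteGaloisGroup K) (x : X), Additive.toMul (ι (g • x)) = g • Additive.toMul (ι x))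
        (_ : ∀ x : X, p ^ M • x = 0)
        (ι₀ : X₀ →+ Additive (AlgebraicClosure K)ˣ) (_ : Function.Injective ι₀)
        (_ : ∀ (g : absoluteGaloisGroup K) (x : X₀), Additive.toMul (ι₀ (g • x)) = g • Additive.toMul (ι₀ x))
        (_ : ∀ m : (AlgebraicClosure K)ˣ, m ^ p ^ k = 1 → ∃ a₀ : X₀, Additive.toMul (ι₀ a₀) = m)
        (t : X →+ X₀) (ht : ∀ (g : absoluteGaloisGroup K) (x : X), t (g • x) = g • t x)
        (_ : ∀ x : X, Additive.toMul (ι₀ (t x)) = Additive.toMul (ι x) ^ p ^ (M - k))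
        (φ : contOneCocycles (discreteTopRep (galFixing K F) X)),
        (∀ σ : absoluteGaloisGroup K, conjH1 (galFixing K F) X σ (oneCocycleClass _ φ) ∈ awayKer (galFixing K F) X v) →
        (∀ w : HeightOneSpectrum (𝓞 K), w ≠ v → w ≠ vbar →
          ∀ σ : absoluteGaloisGroup K, conjH1 (galFixing K F) X σ (oneCocycleClass _ φ) ∈ unramifiedKer (galFixing K F) X w) →
        (∀ β : (AlgebraicClosure K)ˣ, (∀ u : galFixing K F, Additive.toMul (ι (φ.1 u)) = (u : absoluteGaloisGroup K) • β / β) →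
          ∀ b : F, ((b : F) : AlgebraicClosure K) = ((β ^ p ^ M : (AlgebraicClosure K)ˣ) : AlgebraicClosure K) →
          ∀ w' : vbar.Extension (𝓞 F), ((p ^ M : ℕ) : ℤ) ∣ WithZero.log (w'.1.valuation F b)) →
        resH1Hom (ContinuousMonoidHom.id (galFixing K F)) t (fun g x ↦ ht g x) (oneCocycleClass _ φ) = 0 := by
  have hp : p.Prime := Fact.out
  obtain ⟨M, hkM, hM⟩ := exists_level_forall_exists_pow_eq_of_galois' (p := p) hK hv hvbar hne F k
  refine ⟨M, hkM, ?_⟩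
  intro X _ _ _ _ X₀ _ _ _ _ ι hιinj hι hX ι₀ hι₀inj hι₀ hι₀surj t ht htι φ hloc hunr hbar
  -- the trivial twist
  have hι1 : ∀ (g : absoluteGaloisGroup K) (x : X),
      Additive.toMul (ι (g • x)) = (g • Additive.toMul (ι x)) ^ (((1 : absoluteGaloisGroup K →* ℤˣ) g : ℤˣ) : ℤ) := fun g x ↦ by
    rw [hι, MonoidHom.one_apply, Units.val_one, zpow_one]
  have hι₀1 : ∀ (g : absoluteGaloisGroup K) (x : X₀),
      Additive.toMul (ι₀ (g • x)) = (g • Additive.toMul (ι₀ x)) ^ (((1 : absoluteGaloisGroup K →* ℤˣ) g : ℤˣ) : ℤ) := fun g x ↦ by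
    rw [hι₀, MonoidHom.one_apply, Units.val_one, zpow_one]
  -- §1: the attached cocycle `c : Γ_K → K̄ˣ`
  obtain ⟨c, hc, -, -⟩ := exists_twistedCocycle_of_oneCocycle (galFixing K F) (1 : absoluteGaloisGroup K →* ℤˣ) ι hι1 φ hX
  -- Kummer over `U = Gal(K̄/F)`: `c = ∂β` on `U`, `β^{p^M} = b ∈ F`
  have hcoc : ∀ g h : galFixing K F, (fun g : galFixing K F ↦ Additive.toMul (ι (φ.1 g))) (g * h) =
      (fun g : galFixing K F ↦ Additive.toMul (ι (φ.1 g))) g *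
        (g : absoluteGaloisGroup K) • (fun g : galFixing K F ↦ Additive.toMul (ι (φ.1 g))) h := by
    intro g h
    simp only
    have h2 : φ.1 (g * h) = φ.1 g + ((g : absoluteGaloisGroup K) • φ.1 h : X) := φ.2 g h
    rw [h2, map_add, toMul_add, hι]
  have hopen : IsOpen {g : galFixing K F | (fun g : galFixing K F ↦ Additive.toMul (ι (φ.1 g))) g = 1} := by
    have h0 : {g : galFixing K F | (fun g : galFixing K F ↦ Additive.toMul (ι (φ.1 g))) g = 1} = φ.1 ⁻¹' {0} := by
      ext g
      simp only [Set.mem_setOf_eq, Set.mem_preimage, Set.mem_singleton_iff]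
      constructor
      · intro h
        apply hιinj
        rw [map_zero]
        exact Additive.toMul.injective (by rw [h, toMul_zero])
      · intro h
        rw [h, map_zero, toMul_zero]
    rw [h0]
    exact (isOpen_discrete _).preimage φ.1.continuous
  have hn : ∀ g : galFixing K F, (fun g : galFixing K F ↦ Additive.toMul (ι (φ.1 g))) g ^ p ^ M = 1 := fun g ↦ by
    simp only
    rw [← toMul_nsmul, ← map_nsmul, hX, map_zero, toMul_zero]
  obtain ⟨β, b, hb, hcβ⟩ := galFixing.exists_kummer_of_cocycle_charZero F (p ^ M) _ hcoc hopen hn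
  have hres : ∀ u ∈ galFixing K F, c u = u • β / β := fun u hu ↦ by rw [hc u hu]; exact hcβ ⟨u, hu⟩
  have hβM : ((β : AlgebraicClosure K)) ^ p ^ M = ((b : F) : AlgebraicClosure K) := hb.symm
  have hb0 : b ≠ 0 := by
    intro h0
    rw [h0] at hb
    exact (β ^ p ^ M).ne_zero (by rw [Units.val_pow_eq_pow_val]; exact hb.symm.trans (map_zero _))
  -- §2: root forms at `v` and off `v, v̄`
  have hrootv : ∀ σ : absoluteGaloisGroup K, ∃ β' : AlgebraicClosure K, β' ^ p ^ M = ((b : F) : AlgebraicClosure K) ∧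
      ∀ τ : absoluteGaloisGroup K, τ ∈ galFixing K F → σ * τ * σ⁻¹ ∈ decomp v → τ • β' = β' := by
    intro σ
    obtain ⟨β', hβ', hfix⟩ := exists_root_fixed_of_resOfLe_conjH1_eq_zero hι1 φ hX hc le_rfl (fun _ _ ↦ rfl) hres
      (decomp v) σ (hloc σ)
    refine ⟨(β' : AlgebraicClosure K), ?_, fun τ hτ hτD ↦ ?_⟩
    · rw [← hβM, ← Units.val_pow_eq_pow_val, hβ', Units.val_pow_eq_pow_val]
    · rw [← Units.coe_smul, hfix τ hτ hτD]
  have hrootw : ∀ w : HeightOneSpectrum (𝓞 K), w ≠ v → w ≠ vbar → ∀ σ : absoluteGaloisGroup K,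
      ∃ β' : AlgebraicClosure K, β' ^ p ^ M = ((b : F) : AlgebraicClosure K) ∧
        ∀ τ : absoluteGaloisGroup K, τ ∈ galFixing K F → σ * τ * σ⁻¹ ∈ GreenbergSelmer.inertia w → τ • β' = β' := by
    intro w hwv hwvbar σ
    have h0 := (mem_unramifiedKer_iff_resOfLe_inf_inertia_eq_zero (H := galFixing K F) (w := w) _).1 (hunr w hwv hwvbar σ)
    obtain ⟨β', hβ', hfix⟩ := exists_root_fixed_of_resOfLe_conjH1_eq_zero hι1 φ hX hc le_rfl (fun _ _ ↦ rfl) hres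
      (GreenbergSelmer.inertia w) σ h0
    refine ⟨(β' : AlgebraicClosure K), ?_, fun τ hτ hτI ↦ ?_⟩
    · rw [← hβM, ← Units.val_pow_eq_pow_val, hβ', Units.val_pow_eq_pow_val]
    · rw [← Units.coe_smul, hfix τ hτ hτI]
  have hbar' : ∀ w' : vbar.Extension (𝓞 F), ((p ^ M : ℕ) : ℤ) ∣ WithZero.log (w'.1.valuation F b) :=
    hbar β hcβ b (by rw [Units.val_pow_eq_pow_val]; exact hb)
  -- B4d′: `b` is a `p^k`-th power in `F`
  obtain ⟨y₀, hy₀⟩ := hM b hb0 hrootv hrootw hbar'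
  have hy₀0 : y₀ ≠ 0 := by
    intro h0
    rw [h0, zero_pow (pow_ne_zero _ hp.ne_zero)] at hy₀
    exact hb0 hy₀.symm
  -- read back on the cocycle: `(gβ/β)^{p^{M−k}} = gζ/ζ`, `ζ^{p^k} = 1`
  have hβy : (β : AlgebraicClosure K) ^ p ^ M = ((y₀ : F) : AlgebraicClosure K) ^ p ^ k := by
    rw [hβM, ← hy₀]
    rfl
  have hy₀' : ((y₀ : F) : AlgebraicClosure K) ≠ 0 := by
    rw [Ne, ← map_zero (algebraMap F (AlgebraicClosure K))]
    exact fun h ↦ hy₀0 ((algebraMap F (AlgebraicClosure K)).injective h)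
  obtain ⟨ζ, hζ, hζ0, hζcob⟩ := kummerCocycle_pow_eq_of_pow_eq (G := absoluteGaloisGroup K) hp.pos hkM hy₀' hβy
  -- §3: the pushed class vanishes
  refine resH1Hom_id_eq_zero_of_twistedCoboundary ι₀ hι₀inj hι₀1 t ht htι φ hc (hι₀surj (Units.mk0 ζ hζ0) (Units.ext ?_)) ?_
  · rw [Units.val_pow_eq_pow_val, Units.val_mk0, hζ, Units.val_one]
  · intro g hg
    have hgy : g • ((y₀ : F) : AlgebraicClosure K) = (y₀ : F) := (mem_galFixing_iff K).1 hg _ y₀.2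
    apply Units.ext
    rw [hres g hg, MonoidHom.one_apply, Units.val_one, zpow_one, Units.val_pow_eq_pow_val, Units.val_div_eq_div_val,
      Units.coe_smul, Units.val_div_eq_div_val, Units.coe_smul, Units.val_mk0]
    exact hζcob g hgy

end Assembly

end Summit.BirchSwinnertonDyer.BirchSwinnertonDyer.Theorems.PrintCf2.KummerU

end
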